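import Summits.Ventures.WeilGRH.ChristoffelCertificateCheck
import Summits.Ventures.WeilGRH.TwistedGramFormExclusion
import Summits.Ventures.WeilGRH.TwistedGramEntryBoxC
import Summits.Ventures.WeilGRH.TwistedGramEvenComplex
import Summits.Ventures.WeilGRH.TwistedGramCellCheckC
import HarnessLib

/-!
# rh-explicit (venture WeilGRH): CHRISTOFFEL CERTIFICATES FOR `L(s, χ)` — the `χ`-twin of the block checker
  (`Christoffel.checkCertChar`): one integer vector on a block of the TWISTED Gram matrix is a zero-free block /
  multiplicity bound for every measure representing `Q_χ`, and for `L(s, χ)` under `GRH(χ)` (weil-3 gen17, GRH arm)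

Cell `rh-explicit`, WEIL TRACK (structure seat weil-3, gen17; GRH arm cross-over).  The certificate machine of parts I–III
(`ChristoffelCertificate`, `…Check`, `…Mul`) with Yoshida's matrix `G_a` replaced by the hermitian Gram kernel `G^χ_a` of an EVEN
Dirichlet character `χ` mod `q ≠ 1` (`TwistedGramEvenComplex.twistedGramCoeffC`; no pole term, conductor term `log q`, prime
powers weighted by `χ(k)`), boxed by the GRH arm's `TwistedEncl.twistedGramCBox` (`TwistedGramEntryBoxC`, weil-grh-2 and weil-grh-5) over the SAME
certified special-value table as the `ζ` rung of the same support.  The profile of a trigonometric window is character-free, so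
part I's piecewise profile box is reused verbatim.

* `diagValid_rec'` (with `TwistedEncl.diagValid_flip_neg`) — diagonal records at negative modes (the `ζ` files reflected `G(−n,−m) = G(n,m)`
  instead; `G^χ` has no such symmetry for complex `χ`);
* `Christoffel.tgbox`, `trowBox`, `tformBox` (+ `mem_*`) — the twisted form box `∋ Σ c_i c_j Re G^χ_a(n_i, n_j)`;
* ★ `Christoffel.checkCertChar … M` — accept iff `F.hi < M·P.lo` on every piece of the block; `certificate_sound_char`;
* the theorems a passing certificate buys (`χ` even, `q ≠ 1`; via `TwistedGramFormExclusion`):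
  `measureReal_Icc_lt_of_checkCertChar` (**`μ[p/d, p'/d] < M` for every positive `μ` representing `Q_χ`**),
  `measure_Icc_eq_zero_of_natValued_of_checkCertChar` (`M = 1`: ℕ-valued ones VANISH on the block — RH/GRH-free), and under
  `GRH(χ)` for primitive `χ`: ★ `im_not_mem_Icc_of_grh_of_checkCertChar` (**no zero of `L(s, χ)` has its ordinate in the block**)
  and `charZeroHeightMeasure_real_Icc_lt_of_checkCertChar` (fewer than `M` zeros there, with multiplicity);
* `charRe_mem_ofIntList` / `charIm_mem_zeroList` — for a REAL character the value boxes are exact integers.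

Instances (per modulus/character/rung) are separate data files.  No named facts; standard axioms; nothing here bears on the truth
of RH or GRH.
-/

set_option autoImplicit false

noncomputable section

open Complex Set MeasureTheory
open scoped Real ENNReal ComplexConjugate

namespace Summit.Ventures.WeilGRH

open Literature.NumberTheory.LFunctions
open Literature.NumberTheory.LFunctions.Yoshida1992 (chi gramCoeff freq PrimeLen PrimeData)
open Literature.NumberTheory.LFunctions.Yoshida1992.Encl (Consts IdxRec ConstsValid OffValid DiagValid IdxValid TabValid
  tget sgn mem_of_eq)
open Literature.Analysis.ValidatedNumerics.NumericsMP (MI MC)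
open Literature.NumberTheory.LFunctions.ExplicitPsiChar
open Literature.NumberTheory.LFunctions.WeilBochner (charZeroHeightMeasure)
open Summit.RiemannHypothesis.RiemannHypothesis.Theorems.WeilFormatC

variable {a : ℝ} {q : ℕ}

namespace Christoffel

variable {S : ℕ} {ks : List PrimeLen} {C : Consts} {tab : List IdxRec} {Nt : ℕ}

/-! ## Diagonal records at negative modes -/

/-- The record at ANY integer mode of index `< Nt` is diagonally valid. -/
theorem diagValid_rec' (htab : TabValid S a ks Nt tab) {m : ℤ} (hm : m.natAbs < Nt) : DiagValid S a m (rec tab m) := by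
  unfold rec
  split_ifs with h
  · have hv := (htab m.toNat (by omega)).2
    rwa [Int.toNat_of_nonneg h] at hv
  · have hv := (htab (-m).toNat (by omega)).2
    rw [Int.toNat_of_nonneg (by omega)] at hv
    have := TwistedEncl.diagValid_flip_neg hv
    rwa [neg_neg] at this

/-! ## The twisted entry, row and form boxes -/

/-- Entry box of `Re G^χ_a(n,m)` at integer modes (records straight from the table, both signs). -/
def tgbox (S : ℕ) (C : Consts) (xs ys : List MI) (LQ : MI) (tab : List IdxRec) (n m : ℤ) : MI :=
  TwistedEncl.twistedGramCBox S C xs ys LQ (rec tab n) (rec tab m) n m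

/-- **`tgbox ∋ Re G^χ_a(n,m)`** for `|n|, |m| < Nt`. -/
theorem mem_tgbox (hS : 0 < S) (ha0 : 0 < a) (hks : PrimeData a ks) (hC : ConstsValid S a ks C)
    (χ : DirichletCharacter ℂ q) {xs ys : List MI}
    (hx : ∀ i < ks.length, MI.mem S (χ (((ks.getD i default).val : ℕ) : ZMod q)).re (xs.getD i default))
    (hy : ∀ i < ks.length, MI.mem S (χ (((ks.getD i default).val : ℕ) : ZMod q)).im (ys.getD i default))
    {LQ : MI} (hLQ : MI.mem S (Real.log q) LQ) (htab : TabValid S a ks Nt tab) {n m : ℤ} (hn : n.natAbs < Nt)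
    (hm : m.natAbs < Nt) :
    MI.mem S (twistedGramCoeffC χ a n m).re (tgbox S C xs ys LQ tab n m) :=
  TwistedEncl.mem_twistedGramCBox hS ha0 hks hC χ hx hy hLQ (offValid_rec htab hn) (fun _ ↦ diagValid_rec' htab hn)
    (offValid_rec htab hm)

/-- Twisted row box: `Σ_{j<k} Re G^χ(n_i, n_j)·(c_i c_j)`. -/
def trowBox (S : ℕ) (C : Consts) (xs ys : List MI) (LQ : MI) (tab : List IdxRec) (N : ℕ) (c : List ℤ) (i : ℕ) :
    ℕ → MI
  | 0 => MI.ofInt S 0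
  | k + 1 => (trowBox S C xs ys LQ tab N c i k).add
      ((tgbox S C xs ys LQ tab (mode N i) (mode N k)).mulInt (coefAt c i * coefAt c k))

/-- Twisted form box: `Σ_{i<k} Σ_{j<2N+1} Re G^χ(n_i, n_j)·(c_i c_j)`. -/
def tformBox (S : ℕ) (C : Consts) (xs ys : List MI) (LQ : MI) (tab : List IdxRec) (N : ℕ) (c : List ℤ) : ℕ → MI
  | 0 => MI.ofInt S 0
  | k + 1 => (tformBox S C xs ys LQ tab N c k).add (trowBox S C xs ys LQ tab N c k (2 * N + 1))

/-- `trowBox ∋` the row sum. -/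
theorem mem_trowBox (hS : 0 < S) (ha0 : 0 < a) (hks : PrimeData a ks) (hC : ConstsValid S a ks C)
    (χ : DirichletCharacter ℂ q) {xs ys : List MI}
    (hx : ∀ i < ks.length, MI.mem S (χ (((ks.getD i default).val : ℕ) : ZMod q)).re (xs.getD i default))
    (hy : ∀ i < ks.length, MI.mem S (χ (((ks.getD i default).val : ℕ) : ZMod q)).im (ys.getD i default))
    {LQ : MI} (hLQ : MI.mem S (Real.log q) LQ) (htab : TabValid S a ks Nt tab) {N : ℕ} (hN : N < Nt)
    (c : List ℤ) {i : ℕ} (hi : i < 2 * N + 1) :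
    ∀ k, k ≤ 2 * N + 1 →
      MI.mem S (∑ j ∈ Finset.range k,
        (twistedGramCoeffC χ a (mode N i) (mode N j)).re * ((coefAt c i * coefAt c j : ℤ) : ℝ))
        (trowBox S C xs ys LQ tab N c i k)
  | 0, _ => by simpa [trowBox] using MI.mem_ofInt S 0
  | k + 1, hk => by
      rw [Finset.sum_range_succ, trowBox]
      exact MI.mem_add (mem_trowBox hS ha0 hks hC χ hx hy hLQ htab hN c hi k (by omega))
        (MI.mem_mulInt (mem_tgbox hS ha0 hks hC χ hx hy hLQ htab (natAbs_mode_lt hi hN)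
          (natAbs_mode_lt (by omega) hN)) _)

/-- `tformBox ∋` the twisted form. -/
theorem mem_tformBox (hS : 0 < S) (ha0 : 0 < a) (hks : PrimeData a ks) (hC : ConstsValid S a ks C)
    (χ : DirichletCharacter ℂ q) {xs ys : List MI}
    (hx : ∀ i < ks.length, MI.mem S (χ (((ks.getD i default).val : ℕ) : ZMod q)).re (xs.getD i default))
    (hy : ∀ i < ks.length, MI.mem S (χ (((ks.getD i default).val : ℕ) : ZMod q)).im (ys.getD i default))
    {LQ : MI} (hLQ : MI.mem S (Real.log q) LQ) (htab : TabValid S a ks Nt tab) {N : ℕ} (hN : N < Nt)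
    (c : List ℤ) :
    ∀ k, k ≤ 2 * N + 1 →
      MI.mem S (∑ i ∈ Finset.range k, ∑ j ∈ Finset.range (2 * N + 1),
        (twistedGramCoeffC χ a (mode N i) (mode N j)).re * ((coefAt c i * coefAt c j : ℤ) : ℝ))
        (tformBox S C xs ys LQ tab N c k)
  | 0, _ => by simpa [tformBox] using MI.mem_ofInt S 0
  | k + 1, hk => by
      rw [Finset.sum_range_succ, tformBox]
      exact MI.mem_add (mem_tformBox hS ha0 hks hC χ hx hy hLQ htab hN c k (by omega))
        (mem_trowBox hS ha0 hks hC χ hx hy hLQ htab hN c (by omega) (2 * N + 1) le_rfl)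

/-! ## The checker and its soundness -/

/-- **The `χ`-checker.**  As `checkCertMul`, with the twisted form box: scale `S`, `MC.expI` parameters `Kt`, `kr`, Taylor
threshold `yT`; constants `C`, table `tab`; character-value boxes `xs ∋ Re χ(k_i)`, `ys ∋ Im χ(k_i)`, `LQ ∋ log q`; mode radius `N`,
integer coefficients `c`; block `[p/d, p'/d]` in `K` pieces; mass level `M`.  Accept iff `F.hi < M · P.lo` on every piece. -/
def checkCertChar (S Kt kr yT : ℕ) (C : Consts) (tab : List IdxRec) (xs ys : List MI) (LQ : MI) (N : ℕ) (c : List ℤ)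
    (p p' : ℤ) (d K M : ℕ) : Bool :=
  let F := tformBox S C xs ys LQ tab N c (2 * N + 1)
  decide (0 < d) && decide (0 < K) && decide (0 < M) &&
    (List.range K).all fun k ↦
      match profBox S Kt kr yT C tab N c (pieceBox S p p' d K k) (pieceCentre S p p' d K k) with
      | some P => decide (F.hi < (M : ℤ) * P.lo)
      | none => false

/-- The twisted form of a real certificate vector is the range double sum of `Re G^χ` (the shape `mem_tformBox` encloses). -/
theorem re_sum_conj_mul_twistedGramCoeffC_eq (χ : DirichletCharacter ℂ q) (a : ℝ) (N : ℕ) (c : List ℤ) :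
    ∑ n ∈ modes N, ∑ m ∈ modes N, (conj ((coefFun N c n : ℝ) : ℂ) * ((coefFun N c m : ℝ) : ℂ) * twistedGramCoeffC χ a n m).re =
      ∑ i ∈ Finset.range (2 * N + 1), ∑ j ∈ Finset.range (2 * N + 1),
        (twistedGramCoeffC χ a (mode N i) (mode N j)).re * ((coefAt c i * coefAt c j : ℤ) : ℝ) := by
  unfold modes
  rw [Finset.sum_image (mode_injOn N)]
  refine Finset.sum_congr rfl fun i _ ↦ ?_
  rw [Finset.sum_image (mode_injOn N)]
  refine Finset.sum_congr rfl fun j _ ↦ ?_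
  rw [coefFun_mode, coefFun_mode, Complex.conj_ofReal, ← Complex.ofReal_mul, Complex.re_ofReal_mul]
  push_cast
  ring

/-- **SOUNDNESS OF THE `χ`-CHECKER.**  If `checkCertChar … M` accepts then, with `m = (F.hi + ½)/(M S)`, the twisted form of the
certificate's window is `< M·m` and its profile is `≥ m` on the whole block. -/
theorem certificate_sound_char {S : ℕ} (hS : 0 < S) (ha0 : 0 < a) (hks : PrimeData a ks) (hC : ConstsValid S a ks C)
    (χ : DirichletCharacter ℂ q) (heven : charParity χ = 0) {xs ys : List MI}
    (hx : ∀ i < ks.length, MI.mem S (χ (((ks.getD i default).val : ℕ) : ZMod q)).re (xs.getD i default))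
    (hy : ∀ i < ks.length, MI.mem S (χ (((ks.getD i default).val : ℕ) : ZMod q)).im (ys.getD i default))
    {LQ : MI} (hLQ : MI.mem S (Real.log q) LQ) (htab : TabValid S a ks Nt tab) {N : ℕ} (hN : N < Nt)
    {Kt kr yT : ℕ} {c : List ℤ} {p p' : ℤ} {d K M : ℕ}
    (h : checkCertChar S Kt kr yT C tab xs ys LQ N c p p' d K M = true) :
    0 < M ∧
    (weilDirichletEnergyChar χ a (∑ n ∈ modes N, ((coefFun N c n : ℝ) : ℂ) • chi a n) -
        weilMarkovConstantChar χ a * (∫ x : ℝ, ‖(∑ n ∈ modes N, ((coefFun N c n : ℝ) : ℂ) • chi a n) x‖ ^ 2) <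
      (M : ℝ) * ((((tformBox S C xs ys LQ tab N c (2 * N + 1)).hi : ℝ) + 1 / 2) / (M * S))) ∧
      ∀ t ∈ Icc ((p : ℝ) / d) ((p' : ℝ) / d),
        (((tformBox S C xs ys LQ tab N c (2 * N + 1)).hi : ℝ) + 1 / 2) / (M * S) ≤
          ‖weilMellin (∑ n ∈ modes N, ((coefFun N c n : ℝ) : ℂ) • chi a n) (1 / 2 + t * I)‖ ^ 2 := by
  unfold checkCertChar at h
  simp only [Bool.and_eq_true, decide_eq_true_eq, List.all_eq_true, List.mem_range] at h
  obtain ⟨⟨⟨hd, hK⟩, hM⟩, hall⟩ := h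
  have hSr : (0 : ℝ) < S := by exact_mod_cast hS
  have hMr : (0 : ℝ) < M := by exact_mod_cast hM
  set F := tformBox S C xs ys LQ tab N c (2 * N + 1) with hF
  refine ⟨hM, ?_, ?_⟩
  · -- the twisted form is `≤ F.hi/S < (F.hi + ½)/S = M·m`
    rw [twistedWindowForm_sum_smul_chi_eq_twistedGramCoeffC χ heven ha0, re_sum_conj_mul_twistedGramCoeffC_eq]
    have hle := MI.le_hi_div hS (mem_tformBox hS ha0 hks hC χ hx hy hLQ htab hN c (2 * N + 1) le_rfl)
    refine hle.trans_lt ?_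
    rw [mul_div_assoc', div_lt_div_iff₀ hSr (by positivity)]
    nlinarith
  · intro t ht
    obtain ⟨k, hk, h1, h2⟩ := exists_piece hd hK ht
    have hT := mem_pieceBox S hd hK k h1 h2
    have hTc : MI.mem S (((p * (2 * (K : ℤ) - 2 * k - 1) + p' * (2 * k + 1) : ℤ) : ℝ) / ((2 * d * K : ℕ) : ℝ))
        (pieceCentre S p p' d K k) := MI.mem_ofFrac S _ (by positivity)
    have hk' := hall k hk
    split at hk'
    · rename_i P hP
      simp only [decide_eq_true_eq] at hk'
      have hprof := le_profile_of_profBox hS ha0 hC htab hN c hT hTc hP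
      have e : ‖weilMellin (∑ n ∈ modes N, ((coefFun N c n : ℝ) : ℂ) • chi a n) (1 / 2 + t * I)‖ ^ 2 =
          2 * a * (∑ j ∈ Finset.range (2 * N + 1),
            ((coefAt c j : ℤ) : ℝ) * Real.sinc (a * t + π * (mode N j))) ^ 2 := by
        rw [norm_sq_weilMellin_sum_smul_chi_eq_sinc ha0]
        unfold modes
        rw [Finset.sum_image (mode_injOn N)]
        congr 2
        refine Finset.sum_congr rfl fun j _ ↦ ?_
        rw [coefFun_mode]
      rw [e]
      refine le_trans ?_ hprof
      have hint : (F.hi : ℝ) + 1 ≤ (M : ℝ) * (P.lo : ℝ) := by exact_mod_cast hk'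
      rw [div_le_div_iff₀ (by positivity) hSr]
      nlinarith
    · simp at hk'

/-! ## What a passing `χ`-certificate buys -/

/-- **Every measure representing `Q_χ` gives the block mass `< M`** (`χ` even, mod `q ≠ 1`). -/
theorem measureReal_Icc_lt_of_checkCertChar [NeZero q] (hq : q ≠ 1) {S : ℕ} (hS : 0 < S) (ha0 : 0 < a)
    (hks : PrimeData a ks) (hC : ConstsValid S a ks C) (χ : DirichletCharacter ℂ q) (heven : charParity χ = 0)
    {xs ys : List MI}
    (hx : ∀ i < ks.length, MI.mem S (χ (((ks.getD i default).val : ℕ) : ZMod q)).re (xs.getD i default))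
    (hy : ∀ i < ks.length, MI.mem S (χ (((ks.getD i default).val : ℕ) : ZMod q)).im (ys.getD i default))
    {LQ : MI} (hLQ : MI.mem S (Real.log q) LQ) (htab : TabValid S a ks Nt tab) {N : ℕ} (hN : N < Nt)
    {Kt kr yT : ℕ} {c : List ℤ} {p p' : ℤ} {d K M : ℕ}
    (h : checkCertChar S Kt kr yT C tab xs ys LQ N c p p' d K M = true) {μ : Measure ℝ}
    (hμ : ∀ g : ℝ → ℂ, IsWeilTest g → tsupport g ⊆ Icc (-a) a →
      Integrable (fun t : ℝ ↦ ‖weilMellin g (1 / 2 + t * I)‖ ^ 2) μ ∧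
        weilQuadraticChar χ g = ((∫ t, ‖weilMellin g (1 / 2 + t * I)‖ ^ 2 ∂μ : ℝ) : ℂ)) :
    μ.real (Icc ((p : ℝ) / d) ((p' : ℝ) / d)) < M := by
  obtain ⟨hM, hlt, hm⟩ := certificate_sound_char hS ha0 hks hC χ heven hx hy hLQ htab hN h
  exact measureReal_block_lt_of_twistedWindowForm_lt hq χ ha0 hμ (modes N) (fun n ↦ ((coefFun N c n : ℝ) : ℂ))
    (by exact_mod_cast hM) hm hlt

/-- ★ **A `χ`-CERTIFICATE AT LEVEL `M = 1` EXCLUDES EVERY ARITHMETIC LINE FROM ITS BLOCK** (RH/GRH-free): every positive measure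
representing `Q_χ` on the tests of `[-a, a]` that is ℕ-valued on bounded Borel sets vanishes on `[p/d, p'/d]`. -/
theorem measure_Icc_eq_zero_of_natValued_of_checkCertChar [NeZero q] (hq : q ≠ 1) {S : ℕ} (hS : 0 < S) (ha0 : 0 < a)
    (hks : PrimeData a ks) (hC : ConstsValid S a ks C) (χ : DirichletCharacter ℂ q) (heven : charParity χ = 0)
    {xs ys : List MI}
    (hx : ∀ i < ks.length, MI.mem S (χ (((ks.getD i default).val : ℕ) : ZMod q)).re (xs.getD i default))
    (hy : ∀ i < ks.length, MI.mem S (χ (((ks.getD i default).val : ℕ) : ZMod q)).im (ys.getD i default))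
    {LQ : MI} (hLQ : MI.mem S (Real.log q) LQ) (htab : TabValid S a ks Nt tab) {N : ℕ} (hN : N < Nt)
    {Kt kr yT : ℕ} {c : List ℤ} {p p' : ℤ} {d K : ℕ}
    (h : checkCertChar S Kt kr yT C tab xs ys LQ N c p p' d K 1 = true) {μ : Measure ℝ}
    (hμ : ∀ g : ℝ → ℂ, IsWeilTest g → tsupport g ⊆ Icc (-a) a →
      Integrable (fun t : ℝ ↦ ‖weilMellin g (1 / 2 + t * I)‖ ^ 2) μ ∧
        weilQuadraticChar χ g = ((∫ t, ‖weilMellin g (1 / 2 + t * I)‖ ^ 2 ∂μ : ℝ) : ℂ))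
    (hNv : ∀ s : Set ℝ, MeasurableSet s → Bornology.IsBounded s → ∃ k : ℕ, μ.real s = k) :
    μ (Icc ((p : ℝ) / d) ((p' : ℝ) / d)) = 0 := by
  obtain ⟨-, hlt, hm⟩ := certificate_sound_char hS ha0 hks hC χ heven hx hy hLQ htab hN h
  exact measure_block_eq_zero_of_natValued_of_twistedWindowForm_lt hq χ ha0 hμ hNv (modes N)
    (fun n ↦ ((coefFun N c n : ℝ) : ℂ)) hm (by simpa using hlt)

/-- ★ **A `χ`-CERTIFICATE AT LEVEL `1` IS A ZERO-FREE BLOCK FOR `L(s, χ)`** (under `GRH(χ)`, `χ` primitive and even, mod `q ≠ 1`):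
no non-trivial zero of `L(s, χ)` has its ordinate in `[p/d, p'/d]`. -/
theorem im_not_mem_Icc_of_grh_of_checkCertChar [NeZero q] (hq : q ≠ 1) {χ : DirichletCharacter ℂ q}
    (hprim : χ.IsPrimitive) (hGRH : χ.RiemannHypothesis) (heven : charParity χ = 0) {S : ℕ} (hS : 0 < S) (ha0 : 0 < a)
    (hks : PrimeData a ks) (hC : ConstsValid S a ks C) {xs ys : List MI}
    (hx : ∀ i < ks.length, MI.mem S (χ (((ks.getD i default).val : ℕ) : ZMod q)).re (xs.getD i default))
    (hy : ∀ i < ks.length, MI.mem S (χ (((ks.getD i default).val : ℕ) : ZMod q)).im (ys.getD i default))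
    {LQ : MI} (hLQ : MI.mem S (Real.log q) LQ) (htab : TabValid S a ks Nt tab) {N : ℕ} (hN : N < Nt)
    {Kt kr yT : ℕ} {c : List ℤ} {p p' : ℤ} {d K : ℕ}
    (h : checkCertChar S Kt kr yT C tab xs ys LQ N c p p' d K 1 = true)
    {ρ : ℂ} (hρ : ρ ∈ charNontrivialZeros χ) :
    ρ.im ∉ Icc ((p : ℝ) / d) ((p' : ℝ) / d) := by
  obtain ⟨-, hlt, hm⟩ := certificate_sound_char hS ha0 hks hC χ heven hx hy hLQ htab hN h
  exact im_not_mem_block_of_grh_of_twistedWindowForm_lt hq hprim hGRH ha0 (modes N)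
    (fun n ↦ ((coefFun N c n : ℝ) : ℂ)) hm (by simpa using hlt) hρ

/-- **MULTIPLICITY / COUNT in a block** (under `GRH(χ)`, `χ` primitive and even, mod `q ≠ 1`): a `χ`-certificate at level `M` bounds
the number of zeros of `L(s, χ)` with ordinate in `[p/d, p'/d]`, counted with multiplicity, by `< M` (`ν_χ[p/d, p'/d] < M`). -/
theorem charZeroHeightMeasure_real_Icc_lt_of_checkCertChar [NeZero q] (hq : q ≠ 1) {χ : DirichletCharacter ℂ q}
    (hprim : χ.IsPrimitive) (hGRH : χ.RiemannHypothesis) (heven : charParity χ = 0) {S : ℕ} (hS : 0 < S) (ha0 : 0 < a)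
    (hks : PrimeData a ks) (hC : ConstsValid S a ks C) {xs ys : List MI}
    (hx : ∀ i < ks.length, MI.mem S (χ (((ks.getD i default).val : ℕ) : ZMod q)).re (xs.getD i default))
    (hy : ∀ i < ks.length, MI.mem S (χ (((ks.getD i default).val : ℕ) : ZMod q)).im (ys.getD i default))
    {LQ : MI} (hLQ : MI.mem S (Real.log q) LQ) (htab : TabValid S a ks Nt tab) {N : ℕ} (hN : N < Nt)
    {Kt kr yT : ℕ} {c : List ℤ} {p p' : ℤ} {d K M : ℕ}
    (h : checkCertChar S Kt kr yT C tab xs ys LQ N c p p' d K M = true) :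
    (charZeroHeightMeasure χ).real (Icc ((p : ℝ) / d) ((p' : ℝ) / d)) < M := by
  obtain ⟨hM, hlt, hm⟩ := certificate_sound_char hS ha0 hks hC χ heven hx hy hLQ htab hN h
  exact charZeroHeightMeasure_real_block_lt_of_grh hq hprim hGRH ha0 (modes N) (fun n ↦ ((coefFun N c n : ℝ) : ℂ))
    (by exact_mod_cast hM) hm hlt

/-! ## Exact value boxes for a real character -/

/-- The value boxes of an integer list: `ε_i ↦ [ε_i, ε_i]` (exact). -/
def intBoxes (S : ℕ) (εs : List ℤ) : List MI := εs.map (MI.ofInt S)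

/-- Zero boxes of the same length. -/
def zeroBoxes (S : ℕ) (εs : List ℤ) : List MI := εs.map fun _ ↦ MI.ofInt S 0

/-- For a character with INTEGER values `χ(k_i) = ε_i` at the rung's prime powers, `intBoxes` encloses `Re χ(k_i)`. -/
theorem charRe_mem_intBoxes (S : ℕ) (χ : DirichletCharacter ℂ q) {εs : List ℤ} (hlen : εs.length = ks.length)
    (hε : ∀ i < ks.length, χ (((ks.getD i default).val : ℕ) : ZMod q) = ((εs.getD i 0 : ℤ) : ℂ)) :
    ∀ i < ks.length, MI.mem S (χ (((ks.getD i default).val : ℕ) : ZMod q)).re ((intBoxes S εs).getD i default) := by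
  intro i hi
  rw [hε i hi, Complex.intCast_re]
  have e : (intBoxes S εs).getD i default = MI.ofInt S (εs.getD i 0) := by
    unfold intBoxes
    rw [List.getD_eq_getElem?_getD, List.getElem?_map, List.getD_eq_getElem?_getD]
    have hi' : i < εs.length := by omega
    simp [List.getElem?_eq_getElem hi']
  rw [e]
  exact MI.mem_ofInt S _

/-- For a character with INTEGER values at the rung's prime powers, `zeroBoxes` encloses `Im χ(k_i) = 0`. -/
theorem charIm_mem_zeroBoxes (S : ℕ) (χ : DirichletCharacter ℂ q) {εs : List ℤ} (hlen : εs.length = ks.length)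
    (hε : ∀ i < ks.length, χ (((ks.getD i default).val : ℕ) : ZMod q) = ((εs.getD i 0 : ℤ) : ℂ)) :
    ∀ i < ks.length, MI.mem S (χ (((ks.getD i default).val : ℕ) : ZMod q)).im ((zeroBoxes S εs).getD i default) := by
  intro i hi
  rw [hε i hi, Complex.intCast_im]
  have e : (zeroBoxes S εs).getD i default = MI.ofInt S 0 := by
    unfold zeroBoxes
    rw [List.getD_eq_getElem?_getD, List.getElem?_map]
    have hi' : i < εs.length := by omega
    simp [List.getElem?_eq_getElem hi']
  rw [e]
  exact_mod_cast MI.mem_ofInt S 0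

/-! ## Gluing blocks with a numerically checked overlap (used by the `χ` assemblies) -/

/-- Two null blocks `[x, y]`, `[y', z]` with `y' ≤ y` glue to the null block `[x, z]`. -/
theorem measure_Icc_glue {μ : Measure ℝ} {x y y' z : ℝ} (h1 : μ (Icc x y) = 0) (h2 : μ (Icc y' z) = 0) (h : y' ≤ y) :
    μ (Icc x z) = 0 := by
  refine measure_mono_null (fun t ht ↦ ?_) (measure_union_null h1 h2)
  rcases le_or_gt t y with h' | h'
  · exact Or.inl ⟨ht.1, h'⟩
  · exact Or.inr ⟨h.trans h'.le, ht.2⟩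

/-- No ordinate in `[x, y]` and none in `[y', z]` (`y' ≤ y`) ⇒ none in `[x, z]`. -/
theorem not_mem_Icc_glue {s x y y' z : ℝ} (h1 : s ∉ Icc x y) (h2 : s ∉ Icc y' z) (h : y' ≤ y) : s ∉ Icc x z := by
  intro hs
  rcases le_or_gt s y with h' | h'
  · exact h1 ⟨hs.1, h'⟩
  · exact h2 ⟨h.trans h'.le, hs.2⟩

/-! ## Counting over a chain of consecutive blocks -/

/-- `μ[e₀,e₁] + μ[e₁,e₂] + ⋯ + μ[e_{n−1},e_n]` for the endpoint list `[e₁,…,e_n]` after `e₀`. -/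
def chainSum (μ : Measure ℝ) : ℝ → List ℝ → ℝ
  | _, [] => 0
  | e₀, e₁ :: rest => μ.real (Icc e₀ e₁) + chainSum μ e₁ rest

/-- **Subadditivity along a chain**: `μ[e₀, e_n] ≤ μ[e₀,e₁] + ⋯ + μ[e_{n−1},e_n]` (`e_n` = the last endpoint; no ordering needed) for a
measure finite on compact intervals. -/
theorem measureReal_Icc_le_chainSum {μ : Measure ℝ} (hfin : ∀ l r : ℝ, μ (Icc l r) < ⊤) : ∀ (rest : List ℝ) (e₀ e₁ : ℝ),
    μ.real (Icc e₀ ((e₁ :: rest).getLastD e₀)) ≤ chainSum μ e₀ (e₁ :: rest)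
  | [], e₀, e₁ => by simp [chainSum]
  | e₂ :: rest, e₀, e₁ => by
      have ih := measureReal_Icc_le_chainSum hfin rest e₁ e₂
      simp only [List.getLastD_cons] at ih ⊢
      rw [chainSum]
      have hsub : Icc e₀ (rest.getLastD e₂) ⊆ Icc e₀ e₁ ∪ Icc e₁ (rest.getLastD e₂) := by
        intro t ht
        rcases le_or_gt t e₁ with h | h
        · exact Or.inl ⟨ht.1, h⟩
        · exact Or.inr ⟨h.le, ht.2⟩
      calc μ.real (Icc e₀ (rest.getLastD e₂)) ≤ μ.real (Icc e₀ e₁ ∪ Icc e₁ (rest.getLastD e₂)) :=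
            measureReal_mono hsub (measure_union_lt_top_iff.2 ⟨hfin _ _, hfin _ _⟩).ne
        _ ≤ μ.real (Icc e₀ e₁) + μ.real (Icc e₁ (rest.getLastD e₂)) := measureReal_union_le _ _
        _ ≤ μ.real (Icc e₀ e₁) + chainSum μ e₁ (e₂ :: rest) := by linarith

end Christoffel

end Summit.Ventures.WeilGRH

end
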